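import Mathlib
import HarnessLib
import Literature.Analysis.FluidPDE.VectorCalculus
import Literature.Analysis.FluidPDE.VorticityCalculus
import Literature.Analysis.FluidPDE.SphereIntegral
import Literature.Analysis.FluidPDE.KNSSRegularityProofs
import Summits.NavierStokesRegularity.NavierStokesRegularity.Theorems.UnthreadedDoorAntidynamoWallShellMeanSphereMean
import Summits.NavierStokesRegularity.NavierStokesRegularity.Theorems.UnthreadedDoorAntidynamoLambRadial
import Summits.NavierStokesRegularity.NavierStokesRegularity.Theorems.UnthreadedDoorAntidynamoCompositionModuloWall

/-!
# Route `UnthreadedDoor` / `ThreadingFlux`, crux `PoloidalLiouville` (stmt-NavierStokesRegularity-1222), antidynamo v2 skeleton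
# (sha16 `4ebf5683127b`), WALL `stub_scalarLiouville`: THE WALL FROM A KNSS-TYPE ENGINE IN THE SPHERICAL-MEAN GAUGE (by name)

Support file (seat leafhand-ns-unthreadeddoor-2 g5, cell decomp-ns), `--supports stmt-NavierStokesRegularity-1222 --as helper`; theorems only.

KNSS's proof of Theorem 5.2 (arXiv:0709.3599 p. 10) = ENGINE (Lemma 2.1, tree `KNSS2009_lemma21_halfball_holds`: a bounded ancient solution
of `fₜ + a·∇f − Δf = 0` with bounded drift and `sup f = M₁ > 0` is `≥ M₁/2` on parabolic balls of every radius) + OBSTRUCTION (`|ϖ f| ≤ C`).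
For the poloidal wall the obstruction half is the tree's `ShellMean.not_halfballs_sphereMean` (`…WallShellMeanSphereMean`, this seat).  This
file composes the two halves BY NAME:

* `sSup_engine_pack` — bookkeeping: the supremum `M₁` of a bounded `f` over the slab, attained-in-the-limit, as Lemma 2.1 wants it.
* ★ `nonpos_of_sphereMeanEngine` — in the time-dependent class of the wall (`v` jointly smooth, `‖v‖ ≤ V`, `T` jointly smooth off `x₀`,
  `curl v(t) = ∇T(t) × (x − x₀)`), if a function `f` in the elementary solution class of `KNSS2009_lemma21_halfball` (bounded, `C²` slices,
  bounded `∇f, Δf` jointly continuous, `fₜ + a·∇f − Δf = 0` integrated in time, `a` bounded measurable) coincides off the centre with the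
  spherical-mean deviation `T(t,y) − T̄(t, ‖y − x₀‖)`, then `f ≤ 0` (Lemma 2.1 + the ball obstruction).
* ★ `cross_gradient_eq_zero_of_sphere_radial` — a `C¹`-off-the-centre function that is constant on every sphere about `x₀` has radial
  gradient: `∇T × (x − x₀) = 0`.
* ★★ `stubScalarLiouville_of_sphereMeanEngine` — **WALL ⟸ ENGINE**: if for every `(v, x₀, T)` with the binders of `StubScalarLiouville` the
  spherical-mean deviation of `T` extends to a member of Lemma 2.1's class (for some bounded measurable drift), then `StubScalarLiouville`
  holds (apply ★ to `f` and, with `(−v, −T)`, to `−f`; so `T(t,·)` is constant on spheres; ★ finishes).  With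
  `poloidalLiouville_of_stubScalarLiouville` (tree) this is ENGINE ⟹ `PoloidalLiouville` by name.

HONEST LABEL.  The ENGINE is NOT proved and is the open content of the wall: by `…WallPotentialLawTangential` the deviation obeys
`Fₜ + ⟪v_tan, ∇F⟫ − ΔF = −(∂ᵣP/r + κ)`, and membership in Lemma 2.1's class asks the forcing to be absorbed into a bounded drift — expected to
FAIL for a generic member of the class (it holds trivially when `T` is radial, so ENGINE ⟺ WALL: an analytic re-typing, no load moved).
Nothing here proves `stub_scalarLiouville`, `PoloidalLiouville` (1222) or bears on Navier–Stokes regularity; no summit statement is proved.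
[cite: KochNadirashviliSereginSverak2009, Lemma 2.1 (arXiv:0709.3599 p. 5) and proof of Thm 5.2 (p. 10)]
-/

noncomputable section

-- the summit and its single sub-problem share the name (CONVENTIONS §1)
set_option linter.dupNamespace false

open scoped Topology InnerProductSpace RealInnerProductSpace ContDiff Laplacian
open Filter Set Function Metric MeasureTheory intervalIntegral
open Literature.Analysis.FluidPDE

namespace Summit.NavierStokesRegularity.NavierStokesRegularity.Theorems.PoloidalLiouville.Antidynamo

namespace ShellMean

/-! ### §11 Bookkeeping: the supremum over the slab -/

/-- The supremum `M₁` of a bounded function over the slab `t < 0`, with the two properties Lemma 2.1 asks for. [folklore] -/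
theorem sSup_engine_pack {f : ℝ → EuclideanSpace ℝ (Fin 3) → ℝ} (hfb : ∃ C : ℝ, ∀ t < 0, ∀ y, |f t y| ≤ C) :
    ∃ M₁ : ℝ, (∀ t < 0, ∀ y, f t y ≤ M₁) ∧ (∀ ε > 0, ∃ t < 0, ∃ y, M₁ - ε < f t y) ∧
      ∀ t < 0, ∀ y, f t y ≤ 0 ∨ 0 < M₁ := by
  obtain ⟨C, hC⟩ := hfb
  set S : Set ℝ := (fun p : ℝ × EuclideanSpace ℝ (Fin 3) => f p.1 p.2) '' (Iio 0 ×ˢ univ) with hS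
  have hbdd : BddAbove S := ⟨C, by
    rintro _ ⟨p, hp, rfl⟩
    exact (abs_le.mp (hC p.1 (mem_prod.mp hp).1 p.2)).2⟩
  have hne : S.Nonempty := ⟨f (-1) 0, ⟨(-1, 0), ⟨by norm_num, mem_univ _⟩, rfl⟩⟩
  have hmem : ∀ t < 0, ∀ y, f t y ∈ S := fun t ht y => ⟨(t, y), ⟨ht, mem_univ _⟩, rfl⟩
  refine ⟨sSup S, fun t ht y => le_csSup hbdd (hmem t ht y), fun ε hε => ?_, fun t ht y => ?_⟩
  · obtain ⟨s, ⟨p, hp, rfl⟩, hlt⟩ := exists_lt_of_lt_csSup hne (by linarith : sSup S - ε < sSup S)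
    exact ⟨p.1, (mem_prod.mp hp).1, p.2, hlt⟩
  · by_cases h : f t y ≤ 0
    · exact Or.inl h
    · exact Or.inr (lt_of_lt_of_le (not_le.mp h) (le_csSup hbdd (hmem t ht y)))

/-! ### §12 ENGINE + OBSTRUCTION ⇒ the deviation is `≤ 0` -/

/-- ★ **Engine + obstruction ⇒ `f ≤ 0`.**  In the time-dependent class of the wall, a member `f` of the elementary solution class of
`KNSS2009_lemma21_halfball` that coincides off the centre with the spherical-mean deviation `T(t,y) − T̄(t,‖y − x₀‖)` is `≤ 0`
(KNSS Lemma 2.1, tree `KNSS2009_lemma21_halfball_holds`, against `not_halfballs_sphereMean`). [cite: KochNadirashviliSereginSverak2009, proof of Thm 5.2 (arXiv p. 10)] -/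
theorem nonpos_of_sphereMeanEngine
    {v : ℝ → EuclideanSpace ℝ (Fin 3) → EuclideanSpace ℝ (Fin 3)} {x₀ : EuclideanSpace ℝ (Fin 3)}
    {T : ℝ → EuclideanSpace ℝ (Fin 3) → ℝ} {V : ℝ}
    (hsm : ContDiffOn ℝ (⊤ : ℕ∞) (Function.uncurry v) (Set.Iio 0 ×ˢ Set.univ))
    (hsT : ContDiffOn ℝ (⊤ : ℕ∞) (Function.uncurry T) (Set.Iio 0 ×ˢ ({x₀}ᶜ : Set (EuclideanSpace ℝ (Fin 3)))))
    (hV : ∀ t < 0, ∀ x, ‖v t x‖ ≤ V)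
    (hrep : ∀ t < 0, ∀ x, curl (v t) x = cross (gradient (T t) x) (x - x₀))
    {f : ℝ → EuclideanSpace ℝ (Fin 3) → ℝ} {a : ℝ → EuclideanSpace ℝ (Fin 3) → EuclideanSpace ℝ (Fin 3)} {A : ℝ}
    (hfT : ∀ t < 0, ∀ y, y ≠ x₀ → f t y = T t y -
      sphereIntegral volume (fun z => T t (x₀ + z)) ‖y - x₀‖ / ((volume : Measure (EuclideanSpace ℝ (Fin 3))).toSphere).real univ)
    (ha : Measurable (uncurry a)) (haA : ∀ t < 0, ∀ y, ‖a t y‖ ≤ A)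
    (hfb : ∃ C : ℝ, ∀ t < 0, ∀ y, |f t y| ≤ C) (hf2 : ∀ t < 0, ContDiff ℝ 2 (f t))
    (hfD : ∃ C : ℝ, ∀ t < 0, ∀ y, ‖fderiv ℝ (f t) y‖ ≤ C ∧ |(Δ (f t)) y| ≤ C)
    (hcD : ContinuousOn (fun p : ℝ × EuclideanSpace ℝ (Fin 3) => fderiv ℝ (f p.1) p.2) (Iio 0 ×ˢ univ))
    (hcΔ : ContinuousOn (fun p : ℝ × EuclideanSpace ℝ (Fin 3) => (Δ (f p.1)) p.2) (Iio 0 ×ˢ univ))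
    (heq : ∀ y, ∀ s t : ℝ, s ≤ t → t < 0 →
      f t y - f s y = ∫ τ in s..t, ((Δ (f τ)) y - fderiv ℝ (f τ) y (a τ y))) :
    ∀ t < 0, ∀ y, f t y ≤ 0 := by
  obtain ⟨M₁, hM, happ, hdich⟩ := sSup_engine_pack hfb
  intro t ht y
  rcases hdich t ht y with h | hM₁
  · exact h
  · -- `sup f > 0`: Lemma 2.1 gives half-balls of every radius, the obstruction forbids them
    exfalso
    have hballs := KNSS2009_lemma21_halfball_holds (E := EuclideanSpace ℝ (Fin 3)) ha haA hfb hf2 hfD hcD hcΔ heq hM happ hM₁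
    refine not_halfballs_sphereMean hsm hsT hV hrep hM₁ fun R hR => ?_
    obtain ⟨y₀, t₀, ht₀, hb⟩ := hballs R hR
    refine ⟨y₀, t₀, ht₀, fun s hs z hz hzx => ?_⟩
    have hs0 : s < 0 := lt_trans hs.2 ht₀
    rw [← hfT s hs0 z hzx]
    exact hb s hs z hz

/-! ### §13 Sphere-wise constant functions have radial gradient -/

/-- ★ **Sphere-wise constant ⇒ radial gradient.**  If `T` is differentiable off `x₀` and `T y = g ‖y − x₀‖` for all `y ≠ x₀` (with any
`g : ℝ → ℝ`), then `∇T(y) × (y − x₀) = 0` for every `y` (at `x₀` trivially). [folklore] -/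
theorem cross_gradient_eq_zero_of_sphere_radial {T : EuclideanSpace ℝ (Fin 3) → ℝ} {x₀ : EuclideanSpace ℝ (Fin 3)} {g : ℝ → ℝ}
    (hT : ∀ y, y ≠ x₀ → DifferentiableAt ℝ T y) (hTg : ∀ y, y ≠ x₀ → T y = g ‖y - x₀‖) (y : EuclideanSpace ℝ (Fin 3)) :
    cross (gradient T y) (y - x₀) = 0 := by
  by_cases hy : y = x₀
  · rw [hy, sub_self]
    ext i
    fin_cases i <;> simp [cross, crossProduct]
  · have hz : y - x₀ ≠ 0 := sub_ne_zero.mpr hy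
    have hr : 0 < ‖y - x₀‖ := norm_pos_iff.mpr hz
    -- `g` is differentiable at `‖y − x₀‖`: along the ray, `g r = T (x₀ + r n)` near `r₀ = ‖y − x₀‖`
    set n : EuclideanSpace ℝ (Fin 3) := ‖y - x₀‖⁻¹ • (y - x₀) with hn
    have hn1 : ‖n‖ = 1 := by
      rw [hn, norm_smul, norm_inv, norm_norm, inv_mul_cancel₀ hr.ne']
    have hgray : ∀ r, 0 < r → g r = T (x₀ + r • n) := by
      intro r hr0
      have hne : x₀ + r • n ≠ x₀ := centre_add_smul_ne hn1 hr0.ne'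
      rw [hTg _ hne, add_sub_cancel_left, norm_smul, hn1, mul_one, Real.norm_eq_abs, abs_of_pos hr0]
    have hgd : DifferentiableAt ℝ g ‖y - x₀‖ := by
      have hpath : DifferentiableAt ℝ (fun r : ℝ => x₀ + r • n) ‖y - x₀‖ :=
        (differentiableAt_const _).add ((differentiableAt_id).smul_const n)
      have hcomp : DifferentiableAt ℝ (fun r : ℝ => T (x₀ + r • n)) ‖y - x₀‖ := by
        refine DifferentiableAt.comp (‖y - x₀‖) (hT _ ?_) hpath
        exact centre_add_smul_ne hn1 hr.ne'
      refine hcomp.congr_of_eventuallyEq ?_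
      filter_upwards [Ioi_mem_nhds hr] with r hr0 using hgray r hr0
    -- `T = (z ↦ g ‖z‖) ∘ (· − x₀)` near `y`
    have hO : IsOpen (({x₀}ᶜ : Set (EuclideanSpace ℝ (Fin 3)))) := isOpen_compl_singleton
    have hev : T =ᶠ[𝓝 y] fun y' => (fun z : EuclideanSpace ℝ (Fin 3) => g ‖z‖) (y' - x₀) := by
      filter_upwards [hO.mem_nhds hy] with y' hy' using hTg y' hy'
    have hfd : fderiv ℝ T y = fderiv ℝ (fun z : EuclideanSpace ℝ (Fin 3) => g ‖z‖) (y - x₀) := by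
      rw [hev.fderiv_eq]
      have hnorm : DifferentiableAt ℝ (fun z : EuclideanSpace ℝ (Fin 3) => ‖z‖) (y - x₀) :=
        (differentiableAt_id).norm ℝ hz
      have hh : DifferentiableAt ℝ (fun z : EuclideanSpace ℝ (Fin 3) => g ‖z‖) (y - x₀) := hgd.comp (y - x₀) hnorm
      have hcomp := hh.hasFDerivAt.comp y (hasFDerivAt_sub_const x₀)
      rw [ContinuousLinearMap.comp_id] at hcomp
      exact hcomp.fderiv
    have hgrad : gradient T y = gradient (fun z : EuclideanSpace ℝ (Fin 3) => g ‖z‖) (y - x₀) := by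
      rw [gradient, gradient, hfd]
    rw [hgrad, gradient_radial hz hgd, cross_smul_self_left]

/-! ### §14 WALL ⟸ ENGINE (spherical-mean gauge), by name -/

/-- `curl (−v) = ∇(−T) × (x − x₀)` from `curl v = ∇T × (x − x₀)`. [folklore] -/
theorem curl_neg_eq_cross_gradient_neg {v : EuclideanSpace ℝ (Fin 3) → EuclideanSpace ℝ (Fin 3)}
    {T : EuclideanSpace ℝ (Fin 3) → ℝ} {x₀ x : EuclideanSpace ℝ (Fin 3)}
    (h : curl v x = cross (gradient T x) (x - x₀)) :
    curl (fun y => -v y) x = cross (gradient (fun y => -T y) x) (x - x₀) := by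
  rw [curl_neg, h]
  have hg : gradient (fun y => -T y) x = -gradient T x := by
    rw [gradient, gradient, show (fun y => -T y) = -T from rfl, fderiv_neg, map_neg]
  rw [hg]
  ext i
  fin_cases i <;> simp [cross, crossProduct, mul_comm]

/-- The sphere integral commutes with negation. [folklore] -/
theorem sphereIntegral_neg_translate (T : EuclideanSpace ℝ (Fin 3) → ℝ) (x₀ : EuclideanSpace ℝ (Fin 3)) (r : ℝ) :
    sphereIntegral volume (fun z => -T (x₀ + z)) r = -sphereIntegral volume (fun z => T (x₀ + z)) r := by
  rw [sphereIntegral_def, sphereIntegral_def, MeasureTheory.integral_neg]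

/-- ★★ **WALL ⟸ ENGINE (spherical-mean gauge).**  If for every `(v, x₀, T)` carrying the binders of `StubScalarLiouville` the spherical-mean
deviation `T(t,y) − T̄(t,‖y − x₀‖)` extends to a member of the elementary solution class of KNSS's Lemma 2.1 (for some bounded measurable
drift `a`), then `StubScalarLiouville` — hence (`poloidalLiouville_of_stubScalarLiouville`) the crux — holds.  The ENGINE is the open
content of the wall; see the module docstring. [cite: KochNadirashviliSereginSverak2009, proof of Thm 5.2 (arXiv p. 10)] -/
theorem stubScalarLiouville_of_sphereMeanEngine
    (hE : ∀ (v : ℝ → EuclideanSpace ℝ (Fin 3) → EuclideanSpace ℝ (Fin 3)) (x₀ : EuclideanSpace ℝ (Fin 3))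
      (T : ℝ → EuclideanSpace ℝ (Fin 3) → ℝ),
      Literature.Analysis.FluidPDE.IsBoundedAncientMildSolution 1 v →
      (∀ t < 0, AEStronglyMeasurable (v t) volume) →
      ContDiffOn ℝ (⊤ : ℕ∞) (Function.uncurry v) (Set.Iio 0 ×ˢ Set.univ) →
      ContDiffOn ℝ (⊤ : ℕ∞) (Function.uncurry T) (Set.Iio 0 ×ˢ ({x₀}ᶜ : Set (EuclideanSpace ℝ (Fin 3)))) →
      (∃ C : ℝ, ∀ t < 0, ∀ x, |T t x| ≤ C) →
      (∀ t < 0, ∀ x, curl (v t) x = cross (gradient (T t) x) (x - x₀)) →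
      (∀ t < 0, ∀ x, x ≠ x₀ →
        cross (gradient (fun z => deriv (fun s => T s z) t + inner ℝ (v t z) (gradient (T t) z)
              - Laplacian.laplacian (T t) z) x) (x - x₀) =
          cross (gradient (fun z => inner ℝ (v t z) (z - x₀)) x) (gradient (T t) x)) →
      ∃ (f : ℝ → EuclideanSpace ℝ (Fin 3) → ℝ) (a : ℝ → EuclideanSpace ℝ (Fin 3) → EuclideanSpace ℝ (Fin 3)) (A : ℝ),
        (∀ t < 0, ∀ y, y ≠ x₀ → f t y = T t y -
          sphereIntegral volume (fun z => T t (x₀ + z)) ‖y - x₀‖ /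
            ((volume : Measure (EuclideanSpace ℝ (Fin 3))).toSphere).real univ) ∧
        Measurable (uncurry a) ∧ (∀ t < 0, ∀ y, ‖a t y‖ ≤ A) ∧
        (∃ C : ℝ, ∀ t < 0, ∀ y, |f t y| ≤ C) ∧ (∀ t < 0, ContDiff ℝ 2 (f t)) ∧
        (∃ C : ℝ, ∀ t < 0, ∀ y, ‖fderiv ℝ (f t) y‖ ≤ C ∧ |(Δ (f t)) y| ≤ C) ∧
        ContinuousOn (fun p : ℝ × EuclideanSpace ℝ (Fin 3) => fderiv ℝ (f p.1) p.2) (Iio 0 ×ˢ univ) ∧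
        ContinuousOn (fun p : ℝ × EuclideanSpace ℝ (Fin 3) => (Δ (f p.1)) p.2) (Iio 0 ×ˢ univ) ∧
        (∀ y, ∀ s t : ℝ, s ≤ t → t < 0 →
          f t y - f s y = ∫ τ in s..t, ((Δ (f τ)) y - fderiv ℝ (f τ) y (a τ y)))) :
    StubScalarLiouville := by
  intro v x₀ T hB hm hsm hsT hTb hrep hE1 t ht x
  -- the pointwise velocity bound of the class
  obtain ⟨V, hVb⟩ := hB.2
  have hV : ∀ s < 0, ∀ y, ‖v s y‖ ≤ V := fun s hs y => hVb s hs y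
  obtain ⟨f, a, A, hfT, ha, haA, hfb, hf2, hfD, hcD, hcΔ, heq⟩ := hE v x₀ T hB hm hsm hsT hTb hrep hE1
  -- (i) `f ≤ 0`
  have hle : ∀ s < 0, ∀ y, f s y ≤ 0 := nonpos_of_sphereMeanEngine hsm hsT hV hrep hfT ha haA hfb hf2 hfD hcD hcΔ heq
  -- (ii) `−f ≤ 0`: the same for the data `(−v, −T)` and the class member `−f`
  have hsm' : ContDiffOn ℝ (⊤ : ℕ∞) (Function.uncurry fun s y => -v s y) (Set.Iio 0 ×ˢ Set.univ) := hsm.neg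
  have hsT' : ContDiffOn ℝ (⊤ : ℕ∞) (Function.uncurry fun s y => -T s y)
      (Set.Iio 0 ×ˢ ({x₀}ᶜ : Set (EuclideanSpace ℝ (Fin 3)))) := hsT.neg
  have hV' : ∀ s < 0, ∀ y, ‖(fun s y => -v s y) s y‖ ≤ V := fun s hs y => by simpa using hV s hs y
  have hrep' : ∀ s < 0, ∀ y, curl ((fun s y => -v s y) s) y = cross (gradient ((fun s y => -T s y) s) y) (y - x₀) :=
    fun s hs y => curl_neg_eq_cross_gradient_neg (hrep s hs y)
  have hfT' : ∀ s < 0, ∀ y, y ≠ x₀ → (fun s y => -f s y) s y = (fun s y => -T s y) s y -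
      sphereIntegral volume (fun z => (fun s y => -T s y) s (x₀ + z)) ‖y - x₀‖ /
        ((volume : Measure (EuclideanSpace ℝ (Fin 3))).toSphere).real univ := by
    intro s hs y hy
    simp only [hfT s hs y hy, sphereIntegral_neg_translate]
    ring
  obtain ⟨C₁, hC₁⟩ := hfb
  obtain ⟨C₂, hC₂⟩ := hfD
  have hfb' : ∃ C : ℝ, ∀ s < 0, ∀ y, |(fun s y => -f s y) s y| ≤ C := ⟨C₁, fun s hs y => by simpa using hC₁ s hs y⟩
  have hf2' : ∀ s < 0, ContDiff ℝ 2 ((fun s y => -f s y) s) := fun s hs => (hf2 s hs).neg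
  have hDneg : ∀ s, ∀ y, fderiv ℝ ((fun s y => -f s y) s) y = -fderiv ℝ (f s) y := fun s y => by
    show fderiv ℝ (fun y => -f s y) y = -fderiv ℝ (f s) y
    exact fderiv_neg
  have hΔneg : ∀ s, ∀ y, (Δ ((fun s y => -f s y) s)) y = -(Δ (f s)) y := fun s y => by
    show (Δ (-(f s))) y = -(Δ (f s)) y
    rw [InnerProductSpace.laplacian_neg]; rfl
  have hfD' : ∃ C : ℝ, ∀ s < 0, ∀ y, ‖fderiv ℝ ((fun s y => -f s y) s) y‖ ≤ C ∧ |(Δ ((fun s y => -f s y) s)) y| ≤ C :=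
    ⟨C₂, fun s hs y => by rw [hDneg, hΔneg, norm_neg, abs_neg]; exact hC₂ s hs y⟩
  have hcD' : ContinuousOn (fun p : ℝ × EuclideanSpace ℝ (Fin 3) => fderiv ℝ ((fun s y => -f s y) p.1) p.2) (Iio 0 ×ˢ univ) :=
    hcD.neg.congr fun p _ => hDneg p.1 p.2
  have hcΔ' : ContinuousOn (fun p : ℝ × EuclideanSpace ℝ (Fin 3) => (Δ ((fun s y => -f s y) p.1)) p.2) (Iio 0 ×ˢ univ) :=
    hcΔ.neg.congr fun p _ => hΔneg p.1 p.2
  have heq' : ∀ y, ∀ s τ : ℝ, s ≤ τ → τ < 0 →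
      (fun s y => -f s y) τ y - (fun s y => -f s y) s y =
        ∫ σ in s..τ, ((Δ ((fun s y => -f s y) σ)) y - fderiv ℝ ((fun s y => -f s y) σ) y (a σ y)) := by
    intro y s τ hsτ hτ
    have h1 : ∫ σ in s..τ, ((Δ ((fun s y => -f s y) σ)) y - fderiv ℝ ((fun s y => -f s y) σ) y (a σ y)) =
        ∫ σ in s..τ, -((Δ (f σ)) y - fderiv ℝ (f σ) y (a σ y)) := by
      refine intervalIntegral.integral_congr fun σ _ => ?_
      simp only [hDneg, hΔneg, neg_apply]
      ring
    rw [h1, intervalIntegral.integral_neg, ← heq y s τ hsτ hτ]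
    ring
  have hge : ∀ s < 0, ∀ y, -f s y ≤ 0 :=
    nonpos_of_sphereMeanEngine hsm' hsT' hV' hrep' hfT' ha haA hfb' hf2' hfD' hcD' hcΔ' heq'
  -- (iii) so `T(t,·)` is constant on spheres about `x₀`, and its gradient is radial
  have hzero : ∀ y, y ≠ x₀ → T t y =
      (fun r : ℝ => sphereIntegral volume (fun z => T t (x₀ + z)) r /
        ((volume : Measure (EuclideanSpace ℝ (Fin 3))).toSphere).real univ) ‖y - x₀‖ := by
    intro y hy
    show T t y = sphereIntegral volume (fun z => T t (x₀ + z)) ‖y - x₀‖ /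
      ((volume : Measure (EuclideanSpace ℝ (Fin 3))).toSphere).real univ
    have h1 := hle t ht y
    have h2 := hge t ht y
    have h3 : f t y = 0 := le_antisymm h1 (by linarith)
    have h4 := hfT t ht y hy
    linarith
  have hO : IsOpen (({x₀}ᶜ : Set (EuclideanSpace ℝ (Fin 3)))) := isOpen_compl_singleton
  have hι : ContDiff ℝ (⊤ : ℕ∞) fun y : EuclideanSpace ℝ (Fin 3) => (t, y) := contDiff_prodMk_right t
  have hTt : ContDiffOn ℝ (⊤ : ℕ∞) (T t) ({x₀}ᶜ) := hsT.comp hι.contDiffOn fun y hy => ⟨ht, hy⟩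
  have hTd : ∀ y, y ≠ x₀ → DifferentiableAt ℝ (T t) y := fun y hy =>
    (hTt.contDiffAt (hO.mem_nhds hy)).differentiableAt (by simp)
  exact cross_gradient_eq_zero_of_sphere_radial
    (g := fun r : ℝ => sphereIntegral volume (fun z => T t (x₀ + z)) r /
      ((volume : Measure (EuclideanSpace ℝ (Fin 3))).toSphere).real univ) hTd hzero x

end ShellMean

end Summit.NavierStokesRegularity.NavierStokesRegularity.Theorems.PoloidalLiouville.Antidynamo
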